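import Mathlib
import HarnessLib

/-!
# Müller–Schiemann, *Continuum limit of a hierarchical SU(2) lattice gauge theory in 4 dimensions*
# (CMP 110, 1987), Sect. 4 «Reproduction of the Small Field Assumptions», ITS NONPERTURBATIVE END
# (pp. 273–275): the remark under (4.45), the decomposition (4.48)–(4.52) of the numerator of `L(z)`,
# the exponents of (4.59), (4.62), (4.63) «for β large enough», and (4.64)
# `h′(z) = K(z)²{1 + 𝒪(e^{−¼δ₂β^{1−2α}})}` — PROVED (model-free; the displayed inputs are hypotheses)

statement-level skeleton of published theorems with citation tags; proofs where landed; nothing here is a claim about the Yang–Mills mass gap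

**Citation header (reproduction of PUBLISHED work).** V. F. Müller, J. Schiemann, *Continuum limit of a hierarchical
SU(2) lattice gauge theory in 4 dimensions*, Commun. Math. Phys. **110** (1987) 261–286, doi 10.1007/BF01207367
[MullerSchiemann1987], Sect. 4, journal pp. 269, 273–275 (held Project Euclid scan `paper:url-96df5da18d4c`, PDF page =
journal page − 260; the displays (4.1)–(4.10), (4.42)–(4.64) were read by this seat on its own 3× page renders
`run/shared/lean/pub/lit-balaban/lit-balaban-p12/renders-cmp110ms/ms87-cmp110-pdfp009,013,014,015-…-x3.png`).
Lean lane of the lit-balaban YM LIT SWEEP CONTEXT row X1 (register level; zero weight for any token of that table):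
the model is the `d = 4` HIERARCHICAL `SU(2)` gauge model, NOT lattice Yang–Mills.  Sibling of
`MS87TwoLoopCoefficients` (the perturbative part (4.11)–(4.44) of Sect. 4) and of `MS87NonperturbativeBound` (Sect. 5);
this file is the large-field («nonperturbative contribution L(z)») end of the reproduction of (A₃).

**What the paper prints (verbatim; displays image-read).**
* (4.1)–(4.5) p.269: *«Let ξ, ξ′ be fixed positive numbers with 0 < ξ′ < ξ ≤ ¼ (4.1). … χ(v) = χ(v; 0, ξ′β^{−α}) (4.2),
  … h′(z) = {K(z)(1 + L(z))/(1 + L(0))}² (4.3)»* with `K(z) = ∫dv χ(v)g̃(v,z/2)g̃(v,−z/2)/∫dv χ(v)g(v)²` (4.4) and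
  `L(z) = ∫dv[1 − χ(v)]g̃(v,z/2)g̃(v,−z/2)/∫dv χ(v)g̃(v,z/2)g̃(v,−z/2)` (4.5).
* (4.45) p.273: *«|Ṽ₁(z)| ≦ ½D(β′)^{−2}·(β/β′)^{8α}(1 + δ₁)/(32(1 − ξ)⁸[1 − (2 − 2ξ)^{−2}(β/β′)^{2α}]) (4.45).
  With our choice ξ ≦ ¼ the bound is smaller than ½D(β′)^{−2} for β large enough.»* (`δ₁ = 𝒪(β^{5−12α})`,
  `β′ = β + 𝒪(1)`).
* (4.46) p.273: *«|∫dv χ(v)g̃(v,z/2)g̃(v,−z/2)| = |K(z)|∫dμ = … = exp{−(β/2)(x² − y²) + 𝒪(ln β)}»*.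
* (4.47)–(4.52) pp.273–274: `χ± := χ(v; ±z/2, β^{−α})` and *«we decompose the numerator of L(z) as follows,
  replacing where possible g̃(v,±z/2) by h(θ±), θ± = θ(v,±z/2), due to Proposition 1,
  ∫dv[1 − χ(v)]g̃(v,z/2)g̃(v,−z/2) = Σ_{k=1}^4 I^{(k)} (4.48), I^{(1)} = ∫dv[1−χ(v)]χ₊χ₋h(θ₊)h(θ₋) (4.49),
  I^{(2)} = ∫dv[1−χ(v)][1−χ₊]χ₋g̃(v,z/2)h(θ₋) (4.50), I^{(3)} = ∫dv[1−χ(v)]χ₊[1−χ₋]h(θ₊)g̃(v,−z/2) (4.51),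
  I^{(4)} = ∫dv[1−χ(v)][1−χ₊][1−χ₋]g̃(v,z/2)g̃(v,−z/2) (4.52).»*
* (4.53)–(4.59) p.274: *«h(θ) = exp{−βθ² + 𝒪(β^{1−4α})} (4.53) … |g̃(v,±z/2)| ≦ exp{−pβ^{1−2α} + β(y/2)²} (4.56).
  Treating I^{(1)} first we easily deduce from (4.12), (4.13) for |θ±| < β^{−α} and |z| < (β′)^{−α},
  θ₊² + θ₋² = 4w + ½z² + 𝒪(β^{−4α}) (4.57). The support of 1 − χ(v) implies w = 1 − v₀ ≧ ½(ξ′β^{−α})² + 𝒪(β^{−4α})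
  (4.58). Hence we obtain |I^{(1)}| ≦ ∫dv[1−χ(v)]χ₊χ₋exp{−4βw − (β/2)(x²−y²) + 𝒪(β^{1−4α})}
  < exp{−(ξ′)²β^{1−2α} − (β/2)(x² − y²)} (4.59).»*
* (4.60)–(4.64) p.275: *«|h(θ±)| < exp{β(y/2)² + 𝒪(β^{1−4α})} (4.61). Together with (4.56) we infer the bounds
  |I^{(2)}|, |I^{(3)}| < exp{−pβ^{1−2α} + β(y/2)²}·exp{β(y/2)² + 𝒪(β^{1−4α})} < exp{−½(p − ½)β^{1−2α} − (β/2)(x² − y²)}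
  (4.62), due to |x| < (β′)^{−α} and p − ½ > 0 in (A₂). Furthermore, due to |x| < (β′)^{−α},
  |I^{(4)}| < exp{−(p − ½)β^{1−2α} − (β/2)(x² − y²)} (4.63). In the bounds on I^{(k)} we absorbed orders 𝒪(β^{1−4α}) or
  𝒪(β^{−2α}) by part of the negative 𝒪(β^{1−2α}) terms in the exponent, possible for β large enough. Collecting pieces
  we obtain from (4.3), (4.46), (4.48) and (4.59), (4.62), (4.63), the final result for the iterated Gibbs factor in the
  small field region, h′(z) = K(z)²{1 + 𝒪(e^{−¼δ₂β^{1−2α}})}, (4.64) with δ₂ = min[p − ½, (ξ′)²].»*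

**What this file proves (kernel-checked, 0 sorry, standard axioms; no definition, no named fact).**
* §1 **THE REMARK UNDER (4.45)**: for `ξ ≤ ¼`, `0 < t := (β/β′)^{2α} ≤ 21/20` and `0 ≤ δ₁ ≤ 1/20` (i.e. `β/β′` and
  `δ₁` close to their limits `1`, `0` — «for β large enough») the factor of (4.45) is `< 1`:
  `t⁴(1 + δ₁) < 32(1 − ξ)⁸[1 − (2 − 2ξ)^{−2}t]` (`remark445_core`: `(1−ξ)⁸ ≥ (3/4)⁸`, `(2−2ξ)^{−2} ≤ 4/9`, then
  `(21/20)⁵ < 32·(3/4)⁸·(8/15)`), hence `|Ṽ₁(z)| < ½D(β′)^{−2}` (`eq445_lt`).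
* §2 **(4.48)–(4.52)** `eq448`: on any measure space, with the common weight `[1 − χ(v)]`, cut-offs `χ±` and
  small-field representatives (`χ± g̃± = χ± h(θ±)`, Proposition 1), `∫[1−χ]g̃₊g̃₋ = I⁽¹⁾ + I⁽²⁾ + I⁽³⁾ + I⁽⁴⁾` with the
  printed integrands; and the step «∫dv … < exp{…}» on a probability space (`norm_integral_le_of_pointwise`).
* §3 **THE EXPONENTS «for β large enough», constants explicit** (`β, β′ ≥ 1`, `|β − β′| ≤ c` with `c ≥ 1` for
  «β′ = β + 𝒪(1)», `¼ ≤ α < ½` so that `β^{1−4α} ≤ 1`, `𝒪(β^{−4α})` terms as `D·β^{−4α}` with `D ≥ 0`):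
  (4.57)+(4.58)+(4.53) ⟹ the exponent of **(4.59)** once `D + 4D₂ + D₃ ≤ (ξ′)²β^{1−2α}` (`eq459_exponent`);
  the `x²`-term `(β/2)x² ≤ ½β^{1−2α} + c` from `|x| < (β′)^{−α}` (`xterm_le`); (4.56)+(4.61) ⟹ the exponent of
  **(4.62)** once `D + c ≤ ½(p − ½)β^{1−2α}` (`eq462_exponent`); (4.56)² ⟹ the exponent of **(4.63)** once
  `c ≤ pβ^{1−2α}` (`eq463_exponent`).
* §4 **(4.64)**: `e^{−(ξ′)²S} + 2e^{−½(p−½)S} + e^{−(p−½)S} ≤ 4e^{−½δ₂S}`, `δ₂ = min[p − ½, (ξ′)²]` (`sum_exp_le`);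
  with (4.46) in the form `|K∫dμ| ≥ e^{G − C ln β}` (`G = −(β/2)(x² − y²)`), `|L| ≤ 4β^C e^{−½δ₂S}` (`L_bound`) and
  `4β^C e^{−½δ₂S} ≤ e^{−¼δ₂S}` once `ln 4 + C ln β ≤ ¼δ₂S` (`absorb_prefactor`, the «¼» of (4.64)); finally (4.3) with
  `|L(z)|, |L(0)| ≤ ℓ ≤ ¼` gives **`h′(z) = K(z)²(1 + R)`, `|R| ≤ 8ℓ`** (`ratio_sq_sub_one_le`, `eq464`).

**Departures / readings (declared).** (i) Nothing of the model is re-defined: `g̃`, `h`, `θ±`, `χ`, `K`, `L`, `Ṽ₁` enter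
as letters and the displayed relations (4.3), (4.45), (4.46), (4.53), (4.56)–(4.58), (4.61) as hypotheses, exactly as the
print combines them. (ii) `𝒪`-terms are read with explicit nonnegative constants; «for β large enough» is an explicit
threshold inequality in each lemma (no filter). (iii) `(β/β′)^{8α} = t⁴` with `t = (β/β′)^{2α}`; the remark under (4.45)
is proved for `t ≤ 21/20`, `δ₁ ≤ 1/20` (any neighbourhood of `(1, 0)` small enough would do; these two numbers are
ours). (iv) Strict `<` of the print are `≤` except where a strict statement is printed and provable (`eq445_lt`,
`remark445_core`). (v) (4.60)–(4.61), (4.57) themselves (they need `θ²` of Proposition 1) are not derived here.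

**Not claimed.** (A₃) itself, (4.7)–(4.44) (the sibling `MS87TwoLoopCoefficients` certifies (4.12)–(4.44)'s algebra),
(4.46)'s `𝒪(ln β)`, (4.53), (4.56)–(4.58), (4.60)–(4.61); Theorem 1; anything about lattice Yang–Mills or the Clay problem.
-/

open MeasureTheory Set Filter Topology

namespace Literature.MathematicalPhysics.QuantumFieldTheory

namespace MullerSchiemann1987

namespace NonperturbativeL

/-! ## §1 The remark under (4.45): «With our choice ξ ≦ ¼ the bound is smaller than ½D(β′)^{−2} for β large enough» -/

/-- **The factor of (4.45) is `< 1`**: with `t = (β/β′)^{2α}` (so `(β/β′)^{8α} = t⁴`), for `ξ ≤ ¼`, `0 < t ≤ 21/20`,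
`0 ≤ δ₁ ≤ 1/20`: `t⁴(1 + δ₁) < 32(1 − ξ)⁸[1 − (2 − 2ξ)^{−2}t]`. (As `β → ∞`, `t → 1` since `β′ = β + 𝒪(1)` and
`δ₁ = 𝒪(β^{5−12α}) → 0`; at `ξ = ¼`, `t = 1`, `δ₁ = 0` the right side is `32(3/4)⁸(5/9) ≈ 1.78 > 1`.)
[cite: MullerSchiemann1987, (4.45) and the remark below it, p.273] -/
theorem remark445_core {ξ t δ₁ : ℝ} (hξ : ξ ≤ 1 / 4) (ht0 : 0 < t) (ht : t ≤ 21 / 20)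
    (hδ0 : 0 ≤ δ₁) (hδ : δ₁ ≤ 1 / 20) :
    t ^ 4 * (1 + δ₁) < 32 * (1 - ξ) ^ 8 * (1 - t / (2 - 2 * ξ) ^ 2) := by
  have h1 : (3 / 4 : ℝ) ^ 8 ≤ (1 - ξ) ^ 8 := pow_le_pow_left₀ (by norm_num) (by linarith) 8
  have h2d : (9 / 4 : ℝ) ≤ (2 - 2 * ξ) ^ 2 := by nlinarith
  have h2 : t / (2 - 2 * ξ) ^ 2 ≤ 4 / 9 * t := by
    rw [div_le_iff₀ (by positivity)]
    nlinarith
  have h3 : t ^ 4 ≤ (21 / 20 : ℝ) ^ 4 := pow_le_pow_left₀ ht0.le ht 4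
  have h4 : (8 / 15 : ℝ) ≤ 1 - t / (2 - 2 * ξ) ^ 2 := by linarith
  have hL : t ^ 4 * (1 + δ₁) ≤ (21 / 20 : ℝ) ^ 4 * (21 / 20) :=
    mul_le_mul h3 (by linarith) (by linarith) (by positivity)
  have hR : 32 * (3 / 4 : ℝ) ^ 8 * (8 / 15) ≤ 32 * (1 - ξ) ^ 8 * (1 - t / (2 - 2 * ξ) ^ 2) :=
    mul_le_mul (mul_le_mul_of_nonneg_left h1 (by norm_num)) h4 (by norm_num) (by positivity)
  have hnum : (21 / 20 : ℝ) ^ 4 * (21 / 20) < 32 * (3 / 4 : ℝ) ^ 8 * (8 / 15) := by norm_num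
  linarith

/-- **(4.45) ⟹ `|Ṽ₁(z)| < ½D(β′)^{−2}`** in the same regime (`V = |Ṽ₁(z)|`, `B = β′ > 0`, `D > 0`).
[cite: MullerSchiemann1987, (4.45) and the remark below it, p.273] -/
theorem eq445_lt {ξ t δ₁ D B V : ℝ} (hξ : ξ ≤ 1 / 4) (ht0 : 0 < t) (ht : t ≤ 21 / 20)
    (hδ0 : 0 ≤ δ₁) (hδ : δ₁ ≤ 1 / 20) (hD : 0 < D) (hB : 0 < B)
    (hV : V ≤ 1 / 2 * D * B ^ (-(2:ℝ)) * (t ^ 4 * (1 + δ₁) / (32 * (1 - ξ) ^ 8 * (1 - t / (2 - 2 * ξ) ^ 2)))) :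
    V < 1 / 2 * D * B ^ (-(2:ℝ)) := by
  have hcore := remark445_core hξ ht0 ht hδ0 hδ
  have hden : 0 < 32 * (1 - ξ) ^ 8 * (1 - t / (2 - 2 * ξ) ^ 2) :=
    lt_of_le_of_lt (by positivity) hcore
  have hfac : t ^ 4 * (1 + δ₁) / (32 * (1 - ξ) ^ 8 * (1 - t / (2 - 2 * ξ) ^ 2)) < 1 := by
    rw [div_lt_one hden]; exact hcore
  have hpos : 0 < 1 / 2 * D * B ^ (-(2:ℝ)) := by positivity
  calc V ≤ _ := hV
    _ < 1 / 2 * D * B ^ (-(2:ℝ)) * 1 := mul_lt_mul_of_pos_left hfac hpos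
    _ = _ := mul_one _

/-! ## §2 The decomposition (4.48)–(4.52) of the numerator of `L(z)` -/

section Decomposition

variable {V : Type*} [MeasurableSpace V] (μ : Measure V)

/-- The pointwise identity under (4.48)–(4.52): with the common weight `ω = 1 − χ(v)` and `χ±g̃± = χ±h(θ±)`
(«replacing where possible g̃(v,±z/2) by h(θ±) … due to Proposition 1»),
`ω g̃₊g̃₋ = ωχ₊χ₋h₊h₋ + ω(1−χ₊)χ₋g̃₊h₋ + ωχ₊(1−χ₋)h₊g̃₋ + ω(1−χ₊)(1−χ₋)g̃₊g̃₋`. [cite: MullerSchiemann1987, (4.48)–(4.52) pp.273–274] -/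
theorem integrand_decomp448 {ω χp χm g₁ g₂ h₁ h₂ : ℂ} (e₁ : χp * g₁ = χp * h₁) (e₂ : χm * g₂ = χm * h₂) :
    ω * g₁ * g₂ = ω * χp * χm * h₁ * h₂ + ω * (1 - χp) * χm * g₁ * h₂ + ω * χp * (1 - χm) * h₁ * g₂ +
      ω * (1 - χp) * (1 - χm) * g₁ * g₂ := by
  linear_combination ω * ((g₂ - χm * (g₂ - h₂)) * e₁ + g₁ * e₂)

/-- **(4.48)–(4.52): `∫dv[1 − χ(v)]g̃(v,z/2)g̃(v,−z/2) = Σ_{k=1}^4 I^{(k)}`** with the printed integrands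
(4.49)–(4.52) (`ω = 1 − χ`, `χp = χ₊`, `χm = χ₋`, `g₁ = g̃(·,z/2)`, `g₂ = g̃(·,−z/2)`, `h₁ = h(θ₊)`, `h₂ = h(θ₋)`), for any
measure, given `χ±g̃± = χ±h(θ±)` pointwise and integrability of the four products.
[cite: MullerSchiemann1987, (4.48)–(4.52) pp.273–274] -/
theorem eq448 {ω χp χm g₁ g₂ h₁ h₂ : V → ℂ} (e₁ : ∀ v, χp v * g₁ v = χp v * h₁ v)
    (e₂ : ∀ v, χm v * g₂ v = χm v * h₂ v)
    (i₁ : Integrable (fun v => ω v * χp v * χm v * h₁ v * h₂ v) μ)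
    (i₂ : Integrable (fun v => ω v * (1 - χp v) * χm v * g₁ v * h₂ v) μ)
    (i₃ : Integrable (fun v => ω v * χp v * (1 - χm v) * h₁ v * g₂ v) μ)
    (i₄ : Integrable (fun v => ω v * (1 - χp v) * (1 - χm v) * g₁ v * g₂ v) μ) :
    ∫ v, ω v * g₁ v * g₂ v ∂μ =
      (∫ v, ω v * χp v * χm v * h₁ v * h₂ v ∂μ) + (∫ v, ω v * (1 - χp v) * χm v * g₁ v * h₂ v ∂μ) +
        (∫ v, ω v * χp v * (1 - χm v) * h₁ v * g₂ v ∂μ) +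
          ∫ v, ω v * (1 - χp v) * (1 - χm v) * g₁ v * g₂ v ∂μ := by
  have hfun : (fun v => ω v * g₁ v * g₂ v) = fun v =>
      ((ω v * χp v * χm v * h₁ v * h₂ v + ω v * (1 - χp v) * χm v * g₁ v * h₂ v) +
        ω v * χp v * (1 - χm v) * h₁ v * g₂ v) + ω v * (1 - χp v) * (1 - χm v) * g₁ v * g₂ v :=
    funext fun v => integrand_decomp448 (e₁ v) (e₂ v)
  have i12 : Integrable (fun v => ω v * χp v * χm v * h₁ v * h₂ v + ω v * (1 - χp v) * χm v * g₁ v * h₂ v) μ :=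
    i₁.add i₂
  have i123 : Integrable (fun v => (ω v * χp v * χm v * h₁ v * h₂ v + ω v * (1 - χp v) * χm v * g₁ v * h₂ v) +
      ω v * χp v * (1 - χm v) * h₁ v * g₂ v) μ := i12.add i₃
  rw [hfun, integral_add i123 i₄, integral_add i12 i₃, integral_add i₁ i₂]

/-- The step «∫dv [1−χ]χ₊χ₋ exp{…} < exp{…}» of (4.59) (and of (4.62), (4.63), (5.22), (5.23)): on a probability space
(`∫dv = 1`) a pointwise bound of the integrand bounds the integral. [cite: MullerSchiemann1987, (4.59) p.274] -/
theorem norm_integral_le_of_pointwise [IsProbabilityMeasure μ] {F : V → ℂ} {B : ℝ} (h : ∀ v, ‖F v‖ ≤ B) :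
    ‖∫ v, F v ∂μ‖ ≤ B := by
  have := norm_integral_le_of_norm_le_const (μ := μ) (f := F) (C := B) (Eventually.of_forall h)
  simpa using this

end Decomposition

/-! ## §3 The exponents of (4.59), (4.62), (4.63) «for β large enough» -/

section Exponents

/-- `β · β^{−t} = β^{1−t}` (`β > 0`). [folklore] -/
private theorem mul_rpow_neg {β t : ℝ} (hβ : 0 < β) : β * β ^ (-t) = β ^ (1 - t) := by
  rw [sub_eq_add_neg, Real.rpow_add hβ, Real.rpow_one]

/-- `β′^s ≤ β^s + c` for `β′ ≤ β + c`, `c ≥ 1`, `0 ≤ s ≤ 1` («β′ = β + 𝒪(1)» in the `β^{1−2α}` terms; the same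
lemma as in the Sect. 5 sibling, kept private here). [folklore] -/
private theorem rpow_le_rpow_add {β β' c s : ℝ} (hβ : 0 ≤ β) (hβ' : 0 ≤ β') (hc : 1 ≤ c) (h : β' ≤ β + c)
    (hs0 : 0 ≤ s) (hs1 : s ≤ 1) : β' ^ s ≤ β ^ s + c := by
  have hc0 : 0 ≤ c := le_trans zero_le_one hc
  calc β' ^ s ≤ (β + c) ^ s := Real.rpow_le_rpow hβ' h hs0
    _ ≤ β ^ s + c ^ s := Real.rpow_add_le_add_rpow hβ hc0 hs0 hs1
    _ ≤ β ^ s + c := by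
        have : c ^ s ≤ c ^ (1:ℝ) := Real.rpow_le_rpow_of_exponent_le hc hs1
        rw [Real.rpow_one] at this
        linarith

/-- **(4.57) + (4.58) + (4.53) ⟹ THE EXPONENT OF (4.59)**: with `R = Re(θ₊² + θ₋²) ≥ 4w + ½(x² − y²) − D₃β^{−4α}`
((4.57), `Re z² = x² − y²`), `w ≥ ½(ξ′β^{−α})² − D₂β^{−4α}` ((4.58)) and the `𝒪(β^{1−4α})` of (4.53) as `Dβ^{1−4α}`:
`−βR + Dβ^{1−4α} ≤ −(ξ′)²β^{1−2α} − (β/2)(x² − y²)` as soon as `D + 4D₂ + D₃ ≤ (ξ′)²β^{1−2α}` («for β large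
enough»: one `(ξ′)²β^{1−2α}` of the two absorbs the `𝒪(β^{1−4α})`, `β^{1−4α} ≤ 1` for `α ≥ ¼`).
[cite: MullerSchiemann1987, (4.57)–(4.59) p.274] -/
theorem eq459_exponent {α β ξ' w R x y D D₂ D₃ : ℝ} (hα₁ : 1 / 4 ≤ α) (hβ : 1 ≤ β)
    (hD : 0 ≤ D) (hD₂ : 0 ≤ D₂) (hD₃ : 0 ≤ D₃)
    (h457 : 4 * w + (x ^ 2 - y ^ 2) / 2 - D₃ * β ^ (-(4 * α)) ≤ R)
    (h458 : 1 / 2 * (ξ' * β ^ (-α)) ^ 2 - D₂ * β ^ (-(4 * α)) ≤ w)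
    (hlarge : D + 4 * D₂ + D₃ ≤ ξ' ^ 2 * β ^ (1 - 2 * α)) :
    -β * R + D * β ^ (1 - 4 * α) ≤ -(ξ' ^ 2 * β ^ (1 - 2 * α)) - β / 2 * (x ^ 2 - y ^ 2) := by
  have hβ0 : 0 < β := by linarith
  have hF : β ^ (1 - 4 * α) ≤ 1 := Real.rpow_le_one_of_one_le_of_nonpos hβ (by linarith)
  have hF0 : 0 ≤ β ^ (1 - 4 * α) := Real.rpow_nonneg hβ0.le _
  have hE : (β ^ (-α)) ^ 2 = β ^ (-(2 * α)) := by
    rw [← Real.rpow_natCast, ← Real.rpow_mul hβ0.le]; ring_nf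
  have hβF : β * β ^ (-(4 * α)) = β ^ (1 - 4 * α) := mul_rpow_neg hβ0
  have hβE : β * β ^ (-(2 * α)) = β ^ (1 - 2 * α) := mul_rpow_neg hβ0
  -- multiply h457, h458 by β ≥ 0
  have h1 : β * (4 * w + (x ^ 2 - y ^ 2) / 2 - D₃ * β ^ (-(4 * α))) ≤ β * R :=
    mul_le_mul_of_nonneg_left h457 hβ0.le
  have h2 : β * (1 / 2 * (ξ' * β ^ (-α)) ^ 2 - D₂ * β ^ (-(4 * α))) ≤ β * w :=
    mul_le_mul_of_nonneg_left h458 hβ0.le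
  have h1' : β * (4 * w + (x ^ 2 - y ^ 2) / 2 - D₃ * β ^ (-(4 * α))) =
      4 * (β * w) + β / 2 * (x ^ 2 - y ^ 2) - D₃ * (β * β ^ (-(4 * α))) := by ring
  have h2' : β * (1 / 2 * (ξ' * β ^ (-α)) ^ 2 - D₂ * β ^ (-(4 * α))) =
      1 / 2 * ξ' ^ 2 * (β * β ^ (-(2 * α))) - D₂ * (β * β ^ (-(4 * α))) := by rw [mul_pow, hE]; ring
  rw [h1', hβF] at h1
  rw [h2', hβF, hβE] at h2
  have hD' : D * β ^ (1 - 4 * α) ≤ D := mul_le_of_le_one_right hD hF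
  have hD₂' : D₂ * β ^ (1 - 4 * α) ≤ D₂ := mul_le_of_le_one_right hD₂ hF
  have hD₃' : D₃ * β ^ (1 - 4 * α) ≤ D₃ := mul_le_of_le_one_right hD₃ hF
  linarith

/-- **The `x²`-term** («due to |x| < (β′)^{−α}»): `x² ≤ (β′)^{−2α}`, `β, β′ ≥ 1`, `|β − β′| ≤ c` (`c ≥ 1`) ⟹
`(β/2)x² ≤ ½β^{1−2α} + c`. [cite: MullerSchiemann1987, (4.62)–(4.63) p.275] -/
theorem xterm_le {α β β' c x : ℝ} (hα0 : 0 ≤ α) (hα₂ : α < 1 / 2) (hβ : 1 ≤ β) (hβ' : 1 ≤ β') (hc : 1 ≤ c)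
    (h1 : β ≤ β' + c) (h2 : β' ≤ β + c) (hx : x ^ 2 ≤ β' ^ (-(2 * α))) :
    β / 2 * x ^ 2 ≤ 1 / 2 * β ^ (1 - 2 * α) + c := by
  have hβ0 : 0 < β := by linarith
  have hβ'0 : 0 < β' := by linarith
  have hc0 : 0 ≤ c := by linarith
  have hE'1 : β' ^ (-(2 * α)) ≤ 1 := Real.rpow_le_one_of_one_le_of_nonpos hβ' (by linarith)
  have hE'0 : 0 ≤ β' ^ (-(2 * α)) := Real.rpow_nonneg hβ'0.le _
  have hβ's : β' * β' ^ (-(2 * α)) = β' ^ (1 - 2 * α) := mul_rpow_neg hβ'0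
  have hcmp : β' ^ (1 - 2 * α) ≤ β ^ (1 - 2 * α) + c :=
    rpow_le_rpow_add hβ0.le hβ'0.le hc h2 (by linarith) (by linarith)
  have a1 : β / 2 * x ^ 2 ≤ β / 2 * β' ^ (-(2 * α)) := mul_le_mul_of_nonneg_left hx (by linarith)
  have a2 : β / 2 * β' ^ (-(2 * α)) ≤ (β' + c) / 2 * β' ^ (-(2 * α)) :=
    mul_le_mul_of_nonneg_right (by linarith) hE'0
  have a3 : (β' + c) / 2 * β' ^ (-(2 * α)) = 1 / 2 * β' ^ (1 - 2 * α) + c / 2 * β' ^ (-(2 * α)) := by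
    rw [← hβ's]; ring
  have a4 : c / 2 * β' ^ (-(2 * α)) ≤ c / 2 := mul_le_of_le_one_right (by linarith) hE'1
  linarith

/-- **(4.56) + (4.61) ⟹ THE EXPONENT OF (4.62)**: `(−pβ^{1−2α} + β(y/2)²) + (β(y/2)² + Dβ^{1−4α}) ≤
−½(p − ½)β^{1−2α} − (β/2)(x² − y²)` as soon as `D + c ≤ ½(p − ½)β^{1−2α}` («p − ½ > 0 in (A₂)», «for β large
enough»). [cite: MullerSchiemann1987, (4.62) p.275] -/
theorem eq462_exponent {α β β' c p x y D : ℝ} (hα₁ : 1 / 4 ≤ α) (hα₂ : α < 1 / 2) (hβ : 1 ≤ β)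
    (hβ' : 1 ≤ β') (hc : 1 ≤ c) (h1 : β ≤ β' + c) (h2 : β' ≤ β + c) (hx : x ^ 2 ≤ β' ^ (-(2 * α)))
    (hD : 0 ≤ D) (hlarge : D + c ≤ 1 / 2 * (p - 1 / 2) * β ^ (1 - 2 * α)) :
    (-p * β ^ (1 - 2 * α) + β * (y / 2) ^ 2) + (β * (y / 2) ^ 2 + D * β ^ (1 - 4 * α)) ≤
      -(1 / 2 * (p - 1 / 2) * β ^ (1 - 2 * α)) - β / 2 * (x ^ 2 - y ^ 2) := by
  have hxt := xterm_le (by linarith) hα₂ hβ hβ' hc h1 h2 hx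
  have hF : β ^ (1 - 4 * α) ≤ 1 := Real.rpow_le_one_of_one_le_of_nonpos hβ (by linarith)
  have hD' : D * β ^ (1 - 4 * α) ≤ D := mul_le_of_le_one_right hD hF
  linarith

/-- **(4.56)² ⟹ THE EXPONENT OF (4.63)**: `2(−pβ^{1−2α} + β(y/2)²) ≤ −(p − ½)β^{1−2α} − (β/2)(x² − y²)` as soon as
`c ≤ pβ^{1−2α}`. [cite: MullerSchiemann1987, (4.63) p.275] -/
theorem eq463_exponent {α β β' c p x y : ℝ} (hα0 : 0 ≤ α) (hα₂ : α < 1 / 2) (hβ : 1 ≤ β)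
    (hβ' : 1 ≤ β') (hc : 1 ≤ c) (h1 : β ≤ β' + c) (h2 : β' ≤ β + c) (hx : x ^ 2 ≤ β' ^ (-(2 * α)))
    (hlarge : c ≤ p * β ^ (1 - 2 * α)) :
    2 * (-p * β ^ (1 - 2 * α) + β * (y / 2) ^ 2) ≤
      -((p - 1 / 2) * β ^ (1 - 2 * α)) - β / 2 * (x ^ 2 - y ^ 2) := by
  have hxt := xterm_le hα0 hα₂ hβ hβ' hc h1 h2 hx
  linarith

end Exponents

/-! ## §4 (4.64): `h′(z) = K(z)²{1 + 𝒪(e^{−¼δ₂β^{1−2α}})}` -/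

section Eq464

/-- «Collecting pieces … (4.59), (4.62), (4.63)»: with `S = β^{1−2α} ≥ 0`, `a = (ξ′)² ≥ 0`, `b = p − ½ ≥ 0`,
`e^{−aS} + 2e^{−½bS} + e^{−bS} ≤ 4e^{−½ min(b,a) S}` — the origin of `δ₂ = min[p − ½, (ξ′)²]`.
[cite: MullerSchiemann1987, (4.64) p.275] -/
theorem sum_exp_le {a b S : ℝ} (hS : 0 ≤ S) (ha : 0 ≤ a) (hb : 0 ≤ b) :
    Real.exp (-(a * S)) + 2 * Real.exp (-(1 / 2 * b * S)) + Real.exp (-(b * S)) ≤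
      4 * Real.exp (-(1 / 2 * min b a * S)) := by
  have hm1 : min b a ≤ a := min_le_right _ _
  have hm2 : min b a ≤ b := min_le_left _ _
  have hm0 : 0 ≤ min b a := le_min hb ha
  have e1 : Real.exp (-(a * S)) ≤ Real.exp (-(1 / 2 * min b a * S)) :=
    Real.exp_le_exp.mpr (by nlinarith)
  have e2 : Real.exp (-(1 / 2 * b * S)) ≤ Real.exp (-(1 / 2 * min b a * S)) :=
    Real.exp_le_exp.mpr (by nlinarith)
  have e3 : Real.exp (-(b * S)) ≤ Real.exp (-(1 / 2 * min b a * S)) :=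
    Real.exp_le_exp.mpr (by nlinarith)
  linarith

/-- **`|L(z)|` from (4.5), (4.46), (4.48)**: numerator `N = |ΣI^{(k)}| ≤ 4e^{−½δ₂S}e^{G}` (the common factor
`e^{G}`, `G = −(β/2)(x² − y²)`, of (4.59), (4.62), (4.63)), denominator `|K(z)|∫dμ ≥ e^{G − C ln β}` ((4.46) with its
`𝒪(ln β)` as `−C ln β`): `N/(|K|∫dμ) ≤ 4β^{C}e^{−½δ₂S}`. [cite: MullerSchiemann1987, (4.46), (4.64) pp.273–275] -/
theorem L_bound {N Kd G C β δ₂ S : ℝ} (hβ : 1 ≤ β) (hKd : Real.exp (G - C * Real.log β) ≤ Kd)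
    (hN : N ≤ 4 * Real.exp (-(1 / 2 * δ₂ * S)) * Real.exp G) :
    N / Kd ≤ 4 * β ^ C * Real.exp (-(1 / 2 * δ₂ * S)) := by
  have hβ0 : 0 < β := by linarith
  have hKd0 : 0 < Kd := lt_of_lt_of_le (Real.exp_pos _) hKd
  rw [div_le_iff₀ hKd0]
  have hβC : Real.exp (C * Real.log β) = β ^ C := by rw [Real.rpow_def_of_pos hβ0, mul_comm]
  have h1 : 4 * Real.exp (-(1 / 2 * δ₂ * S)) * Real.exp G =
      4 * β ^ C * Real.exp (-(1 / 2 * δ₂ * S)) * Real.exp (G - C * Real.log β) := by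
    rw [← hβC, Real.exp_sub]
    have : Real.exp (C * Real.log β) ≠ 0 := (Real.exp_pos _).ne'
    field_simp
  rw [h1] at hN
  exact hN.trans (mul_le_mul_of_nonneg_left hKd (by positivity))

/-- **The «¼» of (4.64)**: `4β^{C}e^{−½δ₂S} ≤ e^{−¼δ₂S}` as soon as `ln 4 + C ln β ≤ ¼δ₂S` («for β large enough»:
half of `½δ₂β^{1−2α}` absorbs the `𝒪(ln β)`). [cite: MullerSchiemann1987, (4.64) p.275] -/
theorem absorb_prefactor {β C δ₂ S : ℝ} (hβ : 1 ≤ β) (hlarge : Real.log 4 + C * Real.log β ≤ 1 / 4 * δ₂ * S) :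
    4 * β ^ C * Real.exp (-(1 / 2 * δ₂ * S)) ≤ Real.exp (-(1 / 4 * δ₂ * S)) := by
  have hβ0 : 0 < β := by linarith
  have hβC : β ^ C = Real.exp (C * Real.log β) := by rw [Real.rpow_def_of_pos hβ0, mul_comm]
  have key : 4 * β ^ C * Real.exp (-(1 / 2 * δ₂ * S)) =
      Real.exp (Real.log 4 + C * Real.log β + -(1 / 2 * δ₂ * S)) := by
    rw [Real.exp_add, Real.exp_add, Real.exp_log (by norm_num : (0:ℝ) < 4), ← hβC]
  rw [key]
  exact Real.exp_le_exp.mpr (by linarith)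

/-- From (4.3): `|{(1 + L)/(1 + L₀)}² − 1| ≤ 8ℓ` whenever `|L|, |L₀| ≤ ℓ ≤ ¼` (`(1+L)/(1+L₀) = 1 + (L − L₀)/(1 + L₀)`).
[cite: MullerSchiemann1987, (4.3) p.269, (4.64) p.275] -/
theorem ratio_sq_sub_one_le {L L₀ : ℂ} {ℓ : ℝ} (hL : ‖L‖ ≤ ℓ) (hL₀ : ‖L₀‖ ≤ ℓ) (hℓ : ℓ ≤ 1 / 4) :
    ‖((1 + L) / (1 + L₀)) ^ 2 - 1‖ ≤ 8 * ℓ := by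
  have hℓ0 : 0 ≤ ℓ := (norm_nonneg _).trans hL
  have hden : 3 / 4 ≤ ‖1 + L₀‖ := by
    have := norm_add_le (1 + L₀) (-L₀)
    rw [add_neg_cancel_right, norm_one, norm_neg] at this
    linarith
  have hden0 : 1 + L₀ ≠ 0 := by
    intro h; rw [h, norm_zero] at hden; linarith
  -- m := (L − L₀)/(1 + L₀)
  have hq : (1 + L) / (1 + L₀) = 1 + (L - L₀) / (1 + L₀) := by field_simp; ring
  have hm : ‖(L - L₀) / (1 + L₀)‖ ≤ 8 / 3 * ℓ := by
    rw [norm_div, div_le_iff₀ (by linarith)]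
    calc ‖L - L₀‖ ≤ ‖L‖ + ‖L₀‖ := norm_sub_le _ _
      _ ≤ 2 * ℓ := by linarith
      _ = 8 / 3 * ℓ * (3 / 4) := by ring
      _ ≤ 8 / 3 * ℓ * ‖1 + L₀‖ := mul_le_mul_of_nonneg_left hden (by positivity)
  rw [hq]
  set m := (L - L₀) / (1 + L₀) with hm_def
  have hexp : (1 + m) ^ 2 - 1 = m * (2 + m) := by ring
  rw [hexp, norm_mul]
  have h2m : ‖2 + m‖ ≤ 2 + 8 / 3 * ℓ := by
    calc ‖2 + m‖ ≤ ‖(2:ℂ)‖ + ‖m‖ := norm_add_le _ _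
      _ ≤ 2 + 8 / 3 * ℓ := by rw [Complex.norm_ofNat]; linarith
  calc ‖m‖ * ‖2 + m‖ ≤ (8 / 3 * ℓ) * (2 + 8 / 3 * ℓ) := mul_le_mul hm h2m (norm_nonneg _) (by positivity)
    _ ≤ 8 * ℓ := by nlinarith

/-- **(4.64) `h′(z) = K(z)²{1 + 𝒪(e^{−¼δ₂β^{1−2α}})}`**: from (4.3) `h′(z) = {K(z)(1 + L(z))/(1 + L(0))}²` and
`|L(z)|, |L(0)| ≤ ℓ ≤ ¼` (with `ℓ = e^{−¼δ₂β^{1−2α}}` by `L_bound` + `absorb_prefactor`): `h′(z) = K(z)²(1 + R)` with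
`|R| ≤ 8ℓ`. [cite: MullerSchiemann1987, (4.64) p.275] -/
theorem eq464 {h' K L L₀ : ℂ} {ℓ : ℝ} (h43 : h' = (K * (1 + L) / (1 + L₀)) ^ 2) (hL : ‖L‖ ≤ ℓ)
    (hL₀ : ‖L₀‖ ≤ ℓ) (hℓ : ℓ ≤ 1 / 4) :
    ∃ R : ℂ, h' = K ^ 2 * (1 + R) ∧ ‖R‖ ≤ 8 * ℓ := by
  refine ⟨((1 + L) / (1 + L₀)) ^ 2 - 1, ?_, ratio_sq_sub_one_le hL hL₀ hℓ⟩
  rw [h43]; ring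

end Eq464

end NonperturbativeL

end MullerSchiemann1987

end Literature.MathematicalPhysics.QuantumFieldTheory
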